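import Literature.AnabelianGeometry.AbsoluteAnabelian.AbsAnabProp121viiSub
import HarnessLib

/-!
# [AbsAnab] Prop 1.2.1 (vii), sub-DAG row L08 `KummerUniformizerTransport` — PROVED
# (naturality of the Kummer connecting map under the transport along `(α, ψ̄)`)

S. Mochizuki, *The Absolute Anabelian Geometry of Hyperbolic Curves* (2004) [AbsAnab], §1.2,
Prop 1.2.1 (vii) p. 11 (lit key paper:url-e8f118cc205e), printed proof, step N1: "the natural
isomorphism `H²(G_K, μ_{ℚ/ℤ}(K̄)) ⥲ H²(G_K, K̄^×)` — which is group-theoretic, by (iii)".  At finite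
level `n` and in degree `1` this is the compatibility of the Kummer connecting map
`κ_n = δ₀ : (K̄^×)^{G_K} → H¹(G_K, μ_n(K̄))` with the transport along `α : G_{K₁} ≅ G_{K₂}` and an
`α`-equivariant `ψ̄ : K̄₁^× ⥲ K̄₂^×` (row L08 of `plan/L4/SUBDAG-AbsAnab-Prop121vii.md`, typed as
`Prop121vii.KummerUniformizerTransport` in `AbsAnabProp121viiSub.lean`).

Proof-only companion (abc-iut seat w5-d198): pure homological algebra over the tree's explicit
cocycle descriptions — `map_oneCocycleClass` (`ContinuousH1.lean`: `H¹(θ, f)[c] = [f ∘ c ∘ θ]`) and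
`IsSES.δ₀_apply_eq` / `IsSES.f_δ₀Cocycle_apply` (`ContinuousCohomologyConnecting.lean`:
`δ₀ v = [σ ↦ f⁻¹(σ w - w)]` for any lift `w`).  Given a lift `w₁` of `x ∈ K₁^×` (an `n`-th root),
`ψ̄ w₁` is a lift of `ψ̄ x`, and `ψ̄(σ₁ w₁ / w₁) = α(σ₁)·ψ̄ w₁ / ψ̄ w₁` by `α`-equivariance.
No new definitions of mathematical objects; nothing here bears on [IUTchIII] Cor. 3.12.
-/

noncomputable section

universe u

namespace Literature.AnabelianGeometry.AbsoluteAnabelian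

namespace Prop121vii

open Field CategoryTheory ValuativeRel ContRepresentation
open Literature.NumberTheory.GaloisRepresentations
open Literature.NumberTheory.GaloisRepresentations.DiscreteGaloisModule

/-! ### The transport in degree `1` on explicit crossed homomorphisms -/

section TransportLemmas

variable {K₁ K₂ : Type u} [Field K₁] [Field K₂]
variable {M₁ M₂ : Type u} [AddCommGroup M₁] [TopologicalSpace M₁] [DiscreteTopology M₁]
  [AddCommGroup M₂] [TopologicalSpace M₂] [DiscreteTopology M₂]

/-- Pull-back along `θ : G_{K₂} → G_{K₁}` on the class of a crossed homomorphism `c`: the class of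
`c ∘ θ` (Mathlib functoriality, `map_oneCocycleClass`; Serre, *Galois Cohomology* I §2.4, compatible
pairs). [cite: SerreGaloisCohomology1997, I §2.4] -/
theorem pullback_oneCocycleClass (ρ : DiscreteGaloisModule K₁ M₁)
    (θ : absoluteGaloisGroup K₂ →ₜ* absoluteGaloisGroup K₁) (c : contOneCocycles ρ.toTopRep) :
    galoisCohomology.pullback ρ θ 1 (oneCocycleClass _ c) =
      oneCocycleClass (DiscreteGaloisModule.toTopRep (ContinuousRep.restrict ρ θ))
        (contOneCocycles.pullback (X := ρ.toTopRep)
          (Y := DiscreteGaloisModule.toTopRep (ContinuousRep.restrict ρ θ)) θ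
          (TopRep.ofHom ⟨ContinuousLinearMap.id ℤ M₁, fun _ => rfl⟩) c) :=
  map_oneCocycleClass _ _ _ c

/-- Change of coefficients along a continuous intertwining map `I` on the class of a crossed
homomorphism `c`: the class of `I ∘ c` (Mathlib functoriality, `map_oneCocycleClass`; Serre, *Galois
Cohomology* I §2.2). [cite: SerreGaloisCohomology1997, I §2.2] -/
theorem map_oneCocycleClass' {ρ : DiscreteGaloisModule K₂ M₁} {ρ' : DiscreteGaloisModule K₂ M₂}
    (I : ρ.toContRepresentation →ⁱL ρ'.toContRepresentation) (c : contOneCocycles ρ.toTopRep) :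
    galoisCohomology.map I 1 (oneCocycleClass _ c) =
      oneCocycleClass ρ'.toTopRep
        (contOneCocycles.pullback (X := ρ.toTopRep) (Y := ρ'.toTopRep)
          (ContinuousMonoidHom.id (absoluteGaloisGroup K₂))
          (TopRep.ofHom ⟨I.toContinuousLinearMap, I.isIntertwining'⟩) c) :=
  map_oneCocycleClass _ _ _ c

/-- **The transport in degree `1` on the class of a crossed homomorphism** `c : G_{K₁} → M₁` is the
class of `σ₂ ↦ f (c (α⁻¹ σ₂))`. [cite: MochizukiAbsAnab2004, Prop 1.2.1 (vii) p.11] -/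
theorem cohTransport_oneCocycleClass (α : absoluteGaloisGroup K₁ ≃ₜ* absoluteGaloisGroup K₂)
    (ρ₁ : DiscreteGaloisModule K₁ M₁) (ρ₂ : DiscreteGaloisModule K₂ M₂) (f : M₁ →+ M₂)
    (hf : IsEquivariantOver α ρ₁ ρ₂ f) (c : contOneCocycles ρ₁.toTopRep) :
    ∃ c₂ : contOneCocycles ρ₂.toTopRep,
      (∀ σ₂ : absoluteGaloisGroup K₂, c₂.1 σ₂ = f (c.1 (α.symm σ₂))) ∧
        cohTransport α ρ₁ ρ₂ f hf 1 (oneCocycleClass _ c) = oneCocycleClass _ c₂ := by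
  refine ⟨_, fun σ₂ => ?_, (congrArg (galoisCohomology.map (intertwiningOfEquivariant α ρ₁ ρ₂ f hf) 1)
    (pullback_oneCocycleClass ρ₁
      (α.symm : absoluteGaloisGroup K₂ →ₜ* absoluteGaloisGroup K₁) c)).trans
    (map_oneCocycleClass' (intertwiningOfEquivariant α ρ₁ ρ₂ f hf) _)⟩
  rfl

end TransportLemmas

/-! ### Row L08 -/

section KummerTransport

variable {K₁ K₂ : Type u} [Field K₁] [Field K₂]

/-- `ι₂ (ψ̄|μ_n m) = ψ̄ (ι₁ m)` on underlying units (`kummerι` is the inclusion `μ_n ↪ K̄^×`).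
[folklore] -/
private theorem unitsVal_kummerι_muCarrierMap (ψ : (AlgebraicClosure K₁)ˣ ≃* (AlgebraicClosure K₂)ˣ)
    (n : ℕ) (m : MuCarrier K₁ n) :
    unitsVal K₂ ((kummerι K₂ n).hom (muCarrierMap ψ.toMonoidHom n m)) =
      ψ (unitsVal K₁ ((kummerι K₁ n).hom m)) := rfl

/-- **Row L08 `KummerUniformizerTransport` — PROVED**: for an `α`-equivariant
`ψ̄ : K̄₁^× ⥲ K̄₂^×` and `x ∈ (K̄₁^×)^{G_{K₁}}`, `y ∈ (K̄₂^×)^{G_{K₂}}` with `ψ̄ x = y`, the degree-`1`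
transport along `(α, ψ̄|μ_n)` carries the Kummer class `δ₀ x` to `δ₀ y` ([AbsAnab] p. 11, step N1
"the natural isomorphism … group-theoretic by (iii)", at level `n`; naturality of the connecting map).
[cite: MochizukiAbsAnab2004, Prop 1.2.1 (vii) p.11] -/
theorem kummerUniformizerTransport_holds (α : absoluteGaloisGroup K₁ ≃ₜ* absoluteGaloisGroup K₂)
    (ψ : (AlgebraicClosure K₁)ˣ ≃* (AlgebraicClosure K₂)ˣ) (n : ℕ) [NeZero n] :
    KummerUniformizerTransport α ψ n := by
  intro hψ u₁ u₂ hu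
  have h₁ := isSES_kummer K₁ n (NeZero.pos n)
  have h₂ := isSES_kummer K₂ n (NeZero.pos n)
  obtain ⟨w₁, hw₁⟩ := h₁.surjective u₁.1
  let w₂ : UnitsCarrier K₂ := UnitsCarrier.ofUnits (ψ (unitsVal K₁ w₁))
  have hw₁' : unitsVal K₁ w₁ ^ n = unitsVal K₁ (u₁ : UnitsCarrier K₁) := by
    have e := congrArg (unitsVal K₁) hw₁
    rwa [kummerπ_hom_apply, unitsVal_zsmul, zpow_natCast] at e
  have hw₂ : (kummerπ K₂ n).hom w₂ = u₂.1 := by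
    apply unitsVal_injective
    rw [kummerπ_hom_apply, unitsVal_zsmul, zpow_natCast]
    change ψ (unitsVal K₁ w₁) ^ n = unitsVal K₂ (u₂ : UnitsCarrier K₂)
    rw [← map_pow, hw₁', hu]
  rw [h₁.δ₀_apply_eq u₁ w₁ hw₁, h₂.δ₀_apply_eq u₂ w₂ hw₂]
  obtain ⟨c₂, hc₂, hT⟩ := cohTransport_oneCocycleClass α (mu K₁ n) (mu K₂ n)
    (muCarrierMap ψ.toMonoidHom n) (isEquivariantOver_muCarrierMap hψ n)
    (h₁.δ₀Cocycle w₁ (by rw [hw₁]; exact u₁.2))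
  rw [hT]
  refine congrArg _ (Subtype.ext (ContinuousMap.ext fun σ₂ => h₂.injective ?_))
  apply unitsVal_injective
  rw [hc₂, h₂.f_δ₀Cocycle_apply]
  change unitsVal K₂ ((kummerι K₂ n).hom (muCarrierMap ψ.toMonoidHom n _)) = _
  rw [unitsVal_kummerι_muCarrierMap, h₁.f_δ₀Cocycle_apply]
  change ψ (unitsVal K₁ (units K₁ (α.symm σ₂) w₁) / unitsVal K₁ w₁) =
    unitsVal K₂ (units K₂ σ₂ w₂) / unitsVal K₂ w₂
  rw [map_div, unitsVal_apply, unitsVal_apply, hψ, ContinuousMulEquiv.apply_symm_apply]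
  rfl

end KummerTransport

end Prop121vii

end Literature.AnabelianGeometry.AbsoluteAnabelian
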